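import Mathlib
import HarnessLib

/-!
# Cheskidov–Friedlander 2009, §2: the steady state of the forced viscous dyadic model
# (positivity, super-exponential decay, monotonicity, energy identity, injection floor)

Reproduction (a priori part) of: A. Cheskidov, S. Friedlander, *The vanishing viscosity limit for a
dyadic model*, Physica D 238 (2009) 783–787 (arXiv:0810.3718), §2 "The fixed point", for the
Desnyansky–Novikov / Katz–Pavlović dyadic model
`ȧ_j + ν2^{2j}a_j − 2^{c(j−1)}a_{j−1}² + 2^{cj}a_ja_{j+1} = f_j`, `a_{−1} = 0`, forced at the
first shell only (`f_0 > 0`, `f_j = 0` for `j ≥ 1`).  In the rescaled variables of op. cit. §2,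
`α_j = 2^{c/6} f_0^{1/2} 2^{−cj/3} A_j` (so that the inviscid fixed point is `A_j ≡ 1`), a steady
state solves (op. cit. (2.1))
  `A_{j−1}² − A_jA_{j+1} = μ λ^{βj} A_j (j ≥ 1)`,  `A_0A_1 + μA_0 = 1`,
with `λ = 2`, `β = 2(1 − c/3)` and `μ = ν 2^{c/6} f_0^{−1/2}` (substituting the rescaling into the
steady equations; op. cit. prints the constant in `μ` as `λ^{−c/6}`, which does not affect any
statement below).  We write `r := λ^β`; the paper's range `c ∈ (3/2, 5/2]` gives `β ∈ [1/3, 1)`,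
i.e. `1 < r < 2`, and only `1 < r < 2` (resp. `1 < r`) is used.

What is proved here, for a positive bounded solution `A` (`IsSteadyState μ r A`; finite-energy
steady states are positive and tend to `0`, op. cit. Lemma 2.1 — positivity and boundedness are
taken as the defining hypotheses, existence is NOT reproduced):
* `IsSteadyState.lt_div` — the decay bound `A_{j+1} < A_0²/(μ r^{j+1})` (proof of Lemma 2.4,
  display `A_{j+1} < A_j²/(μλ^{β(j+1)})`, with `A_j ≤ A_0`), and `tendsto_zero`;
* `IsSteadyState.strictAnti` — **Theorem 2.2**: every such steady state is strictly decreasing,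
  `A_{j+1} < A_j`, when `1 < r < 2` (the printed induction on the increments `h_j = A_j − A_{j−1}`:
  a non-negative increment forces increments of alternating sign whose negative ones exceed
  `μλ^{βj}` in modulus, contradicting boundedness);
* `IsSteadyState.hasSum_dissipation` — the steady ENERGY IDENTITY `μ Σ_j λ^{βj} A_j² = A_0`
  (first display in the proof of Lemma 2.1): in the original variables
  `ν Σ_j 2^{2j} α_j² = f_0 α_0`, dissipation = injected power;
* `IsSteadyState.one_lt`, `IsSteadyState.pow_four_lt` — the two-sided pinching
  `1 − μA_0 < A_0²` and `A_0⁴ < 1 + μ r A_0` (the `j = 0, 1` cases of the monotonicity, cf.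
  Lemma 2.3: `A_j → 1` as `μ → 0`), whence the **injection floor** `IsSteadyState.half_lt`:
  `A_0 > 1/2` for all `μ ≤ 1`.  In the original variables: every steady state of the dyadic model
  with `ν ≤ 2^{−c/6} f_0^{1/2}` dissipates `ν‖α‖²_{H¹} = f_0α_0 > 2^{c/6} f_0^{3/2}/2`, a floor
  INDEPENDENT of `ν` — the steady-state form of the dissipation anomaly of op. cit. Thm. 4.2
  (`ε^ν → ε_d = f_0 α_0⁰ > 0`).

Relation to the tree: `Literature/Barriers/NavierStokesRegularity/DyadicCascade*.lean` treat the
UNFORCED Barbato–Morandin–Romito normalisation of the same model (time-dependent problem,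
regularity); the present file is about steady states of the FORCED model and shares no
definitions with them.  Not reproduced: existence/uniqueness of the steady state, the global
attractor (op. cit. §3) and the limit `ν → 0` of time averages (Thm. 4.2).
-/

noncomputable section

open Filter Finset
open scoped Topology BigOperators

namespace Literature.Analysis.FluidPDE.CheskidovFriedlander2009

/-- **Steady states of the forced viscous dyadic model in rescaled variables** (Cheskidov–
Friedlander 2009, §2, eq. (2.1), with `r = λ^β = 2^{2(1−c/3)}` and `μ = ν2^{c/6}f_0^{−1/2}`):
a positive bounded sequence `A : ℕ → ℝ` with `A_0A_1 + μA_0 = 1` and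
`A_j² − A_{j+1}A_{j+2} = μ r^{j+1} A_{j+1}` for all `j ≥ 0` (the printed
`A_{j−1}² − A_jA_{j+1} = μλ^{βj}A_j`, `j ≥ 1`, shifted by one).  Positivity and boundedness hold
for every finite-energy steady state (op. cit. Lemma 2.1 and the sentence after it); they are part
of the definition here. [cite: CheskidovFriedlander2009, §2 (2.1)] -/
structure IsSteadyState (μ r : ℝ) (A : ℕ → ℝ) : Prop where
  /-- `A_j > 0` for all `j` (op. cit. Lemma 2.1). -/
  pos : ∀ j, 0 < A j
  /-- The forced shell: `A_0A_1 + μA_0 = 1`. -/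
  eq_zero : A 0 * A 1 + μ * A 0 = 1
  /-- The unforced shells: `A_j² − A_{j+1}A_{j+2} = μ r^{j+1} A_{j+1}`, `j ≥ 0`. -/
  eq_succ : ∀ j, A j ^ 2 - A (j + 1) * A (j + 2) = μ * r ^ (j + 1) * A (j + 1)
  /-- `A` is bounded (finite energy). -/
  bddAbove : ∃ M : ℝ, ∀ j, A j ≤ M

namespace IsSteadyState

variable {μ r : ℝ} {A : ℕ → ℝ}

/-- `A_1 = 1/A_0 − μ` (op. cit. (2.3), first line). [cite: CheskidovFriedlander2009, §2 (2.3)] -/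
theorem A_one_eq (h : IsSteadyState μ r A) : A 1 = 1 / A 0 - μ := by
  have h0 := h.pos 0
  have := h.eq_zero
  field_simp
  linarith

/-- `A_{j+2} = A_j²/A_{j+1} − μ r^{j+1}` (op. cit. (2.3), second line).
[cite: CheskidovFriedlander2009, §2 (2.3)] -/
theorem A_add_two_eq (h : IsSteadyState μ r A) (j : ℕ) :
    A (j + 2) = A j ^ 2 / A (j + 1) - μ * r ^ (j + 1) := by
  have h1 := h.pos (j + 1)
  have := h.eq_succ j
  field_simp
  linarith

/-- **Odd step of the monotonicity induction**: if `A_{j+1} ≥ A_j` then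
`A_{j+2} ≤ A_{j+1} − μ r^{j+1}` (op. cit. proof of Thm. 2.2: `h_J ≥ 0 ⇒ h_{J+1} < −μλ^{βJ}`).
[cite: CheskidovFriedlander2009, Thm 2.2] -/
theorem step_odd (h : IsSteadyState μ r A) {j : ℕ} (hj : A j ≤ A (j + 1)) :
    A (j + 2) ≤ A (j + 1) - μ * r ^ (j + 1) := by
  have h0 := h.pos j
  have h1 := h.pos (j + 1)
  have he := h.eq_succ j
  -- `A_{j+1} A_{j+2} = A_j² − μ r^{j+1} A_{j+1} ≤ A_{j+1}² − μ r^{j+1} A_{j+1}`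
  have hsq : A j ^ 2 ≤ A (j + 1) ^ 2 := by gcongr
  have hmul : A (j + 1) * A (j + 2) ≤ A (j + 1) * (A (j + 1) - μ * r ^ (j + 1)) := by nlinarith
  exact le_of_mul_le_mul_left hmul h1

/-- **Even step of the monotonicity induction** (needs `0 ≤ μ`, `r < 2`): if
`A_{j+2} ≤ A_{j+1} − μ r^{j+1}` then `A_{j+3} ≥ A_{j+2}` (op. cit. proof of Thm. 2.2:
`h_{J+2} > μλ^{βJ}(2 − λ^β) > 0`). [cite: CheskidovFriedlander2009, Thm 2.2] -/
theorem step_even (h : IsSteadyState μ r A) (hμ : 0 ≤ μ) (hr0 : 0 ≤ r) (hr : r < 2) {j : ℕ}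
    (hj : A (j + 2) ≤ A (j + 1) - μ * r ^ (j + 1)) : A (j + 2) ≤ A (j + 3) := by
  have h1 := h.pos (j + 1)
  have h2 := h.pos (j + 2)
  have he := h.eq_succ (j + 1)
  -- with `x = A_{j+2}`, `m = μ r^{j+1} ≥ 0`: `A_{j+1} ≥ x + m`, `μ r^{j+2} = r m ≤ 2m`, so
  -- `A_{j+2}A_{j+3} = A_{j+1}² − r m x ≥ (x+m)² − 2 m x ≥ x²`.
  have hm : 0 ≤ μ * r ^ (j + 1) := by positivity
  have hxm : A (j + 2) + μ * r ^ (j + 1) ≤ A (j + 1) := by linarith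
  have hsq : (A (j + 2) + μ * r ^ (j + 1)) ^ 2 ≤ A (j + 1) ^ 2 :=
    pow_le_pow_left₀ (by linarith) hxm 2
  have hr2 : μ * r ^ (j + 1 + 1) * A (j + 1 + 1) ≤ 2 * (μ * r ^ (j + 1)) * A (j + 2) := by
    have : μ * r ^ (j + 1 + 1) = r * (μ * r ^ (j + 1)) := by ring
    rw [this, show j + 1 + 1 = j + 2 from rfl]
    have := mul_le_mul_of_nonneg_right (mul_le_mul_of_nonneg_right hr.le hm) h2.le
    linarith
  have hmul : A (j + 2) * A (j + 2) ≤ A (j + 2) * A (j + 3) := by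
    rw [show j + 1 + 2 = j + 3 from rfl, show j + 1 + 1 = j + 2 from rfl] at he
    nlinarith
  exact le_of_mul_le_mul_left hmul h2

/-- **Theorem 2.2** (monotonicity): for `0 < μ` and `1 < r < 2` every steady state is strictly
decreasing, `A_{j+1} < A_j` for all `j`.  Printed proof: were `A_{J+1} ≥ A_J`, the odd/even steps
give `A_{J+2k+1} ≥ A_{J+2k+2} + μ r^{J+2k+1} > μ r^{J+2k+1} → ∞`, contradicting boundedness.
[cite: CheskidovFriedlander2009, Thm 2.2] -/
theorem strictAnti (h : IsSteadyState μ r A) (hμ : 0 < μ) (hr1 : 1 < r) (hr2 : r < 2) (j : ℕ) :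
    A (j + 1) < A j := by
  by_contra hcon
  push Not at hcon
  -- induction: `A_{j+2k} ≤ A_{j+2k+1}` for all `k`
  have hind : ∀ k, A (j + 2 * k) ≤ A (j + 2 * k + 1) := by
    intro k
    induction k with
    | zero => simpa using hcon
    | succ k ih =>
      have h1 := h.step_odd ih
      have h2 := h.step_even hμ.le (by linarith) hr2 h1
      simpa [show j + 2 * (k + 1) = j + 2 * k + 2 by ring,
        show j + 2 * k + 2 + 1 = j + 2 * k + 3 by ring] using h2
  -- hence `μ r^{j+2k+1} < A_{j+2k+1} ≤ M` for all `k`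
  obtain ⟨M, hM⟩ := h.bddAbove
  have hlow : ∀ k, μ * r ^ (j + 2 * k + 1) < M := by
    intro k
    have h1 := h.step_odd (hind k)
    have h2 := h.pos (j + 2 * k + 2)
    have h3 := hM (j + 2 * k + 1)
    linarith
  -- but `r^n` is unbounded
  obtain ⟨n, hn⟩ := pow_unbounded_of_one_lt (M / μ) hr1
  have hmono : r ^ n ≤ r ^ (j + 2 * n + 1) := pow_le_pow_right₀ hr1.le (by omega)
  have := hlow n
  rw [div_lt_iff₀ hμ] at hn
  nlinarith

/-- `A_j ≤ A_0` for all `j` (from the monotonicity). [cite: CheskidovFriedlander2009, Thm 2.2] -/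
theorem le_A_zero (h : IsSteadyState μ r A) (hμ : 0 < μ) (hr1 : 1 < r) (hr2 : r < 2) (j : ℕ) :
    A j ≤ A 0 := by
  induction j with
  | zero => exact le_rfl
  | succ j ih => exact (h.strictAnti hμ hr1 hr2 j).le.trans ih

/-- **Super-exponential decay bound**: `A_{j+1} < A_0² / (μ r^{j+1})` (op. cit. proof of Lemma 2.4,
`A_{j+1} < A_j²/(μλ^{β(j+1)})`, combined with `A_j ≤ A_0`). [cite: CheskidovFriedlander2009, Lemma 2.4] -/
theorem lt_div (h : IsSteadyState μ r A) (hμ : 0 < μ) (hr1 : 1 < r) (hr2 : r < 2) (j : ℕ) :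
    A (j + 1) < A 0 ^ 2 / (μ * r ^ (j + 1)) := by
  have he := h.eq_succ j
  have h1 := h.pos (j + 1)
  have h2 := h.pos (j + 2)
  have hw : 0 < μ * r ^ (j + 1) := by positivity
  have hA : A j ^ 2 ≤ A 0 ^ 2 := by
    have := h.le_A_zero hμ hr1 hr2 j
    have := h.pos j
    gcongr
  rw [lt_div_iff₀ hw]
  nlinarith [mul_pos h1 h2]

/-- Steady states tend to zero: `A_j → 0` (op. cit. after Lemma 2.1: "`A_j` decays
super-exponentially"). [cite: CheskidovFriedlander2009, Lemma 2.1] -/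
theorem tendsto_zero (h : IsSteadyState μ r A) (hμ : 0 < μ) (hr1 : 1 < r) (hr2 : r < 2) :
    Tendsto A atTop (𝓝 0) := by
  -- squeeze between `0` and `A_0²/μ · (r⁻¹)^j`, shifted by one
  have hr0 : 0 < r := by linarith
  have hg : Tendsto (fun j : ℕ => A 0 ^ 2 / μ * (r⁻¹) ^ j) atTop (𝓝 0) := by
    have := tendsto_pow_atTop_nhds_zero_of_lt_one (inv_nonneg.2 hr0.le) (inv_lt_one_of_one_lt₀ hr1)
    simpa using this.const_mul (A 0 ^ 2 / μ)
  have hshift : Tendsto (fun j : ℕ => A (j + 1)) atTop (𝓝 0) := by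
    refine squeeze_zero (fun j => (h.pos (j + 1)).le) (fun j => ?_)
      ((hg.comp (tendsto_add_atTop_nat 1)))
    have := h.lt_div hμ hr1 hr2 j
    simp only [Function.comp_apply]
    rw [inv_pow, ← div_eq_mul_inv, div_div]
    exact this.le
  exact (tendsto_add_atTop_iff_nat 1).1 hshift

/-- **Partial energy identity**: `μ Σ_{j ≤ N} r^j A_j² = A_0 − A_N² A_{N+1}` (multiply the `j`-th
steady equation by `A_j` and telescope; op. cit. proof of Lemma 2.1).
[cite: CheskidovFriedlander2009, Lemma 2.1] -/
theorem sum_dissipation_eq (h : IsSteadyState μ r A) (N : ℕ) :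
    ∑ j ∈ range (N + 1), μ * r ^ j * A j ^ 2 = A 0 - A N ^ 2 * A (N + 1) := by
  induction N with
  | zero =>
    simp only [zero_add, range_one, sum_singleton, pow_zero, mul_one]
    linear_combination (A 0) * h.eq_zero
  | succ N ih =>
    rw [sum_range_succ, ih]
    have : μ * r ^ (N + 1) * A (N + 1) ^ 2 = A N ^ 2 * A (N + 1) - A (N + 1) ^ 2 * A (N + 2) := by
      linear_combination (-(A (N + 1))) * h.eq_succ N
    rw [this]
    ring

/-- **Energy identity of the steady state**: `μ Σ_j r^j A_j² = A_0` — in the original variables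
`ν Σ_j 2^{2j} α_j² = f_0 α_0`: the dissipation of a steady state equals the power injected at the
forced shell (op. cit. proof of Lemma 2.1, first display; used in the proof of Thm. 4.2 as
`ν‖α^ν‖²_{H¹} = (α^ν, f)`). [cite: CheskidovFriedlander2009, Lemma 2.1] -/
theorem hasSum_dissipation (h : IsSteadyState μ r A) (hμ : 0 < μ) (hr1 : 1 < r) (hr2 : r < 2) :
    HasSum (fun j => μ * r ^ j * A j ^ 2) (A 0) := by
  have hr0 : 0 < r := by linarith
  refine (hasSum_iff_tendsto_nat_of_nonneg (fun j => ?_) _).2 ?_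
  · have := h.pos j
    positivity
  have heq : (fun N : ℕ => ∑ j ∈ range N, μ * r ^ j * A j ^ 2) ∘ (fun N => N + 1) =
      fun N => A 0 - A N ^ 2 * A (N + 1) := by
    funext N
    exact h.sum_dissipation_eq N
  have hlim : Tendsto (fun N : ℕ => A 0 - A N ^ 2 * A (N + 1)) atTop (𝓝 (A 0)) := by
    have h0 := h.tendsto_zero hμ hr1 hr2
    have h1 : Tendsto (fun N : ℕ => A (N + 1)) atTop (𝓝 0) := h0.comp (tendsto_add_atTop_nat 1)
    have := (h0.pow 2).mul h1
    simpa using this.const_sub (A 0)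
  rw [← heq] at hlim
  exact (tendsto_add_atTop_iff_nat 1).1 hlim

/-- Lower pinching of the forced amplitude: `1 − μA_0 < A_0²` (from `A_1 < A_0` and
`A_0A_1 = 1 − μA_0`; the `j = 0` case of Thm. 2.2, cf. Lemma 2.3).
[cite: CheskidovFriedlander2009, Lemma 2.3] -/
theorem one_lt (h : IsSteadyState μ r A) (hμ : 0 < μ) (hr1 : 1 < r) (hr2 : r < 2) :
    1 < A 0 ^ 2 + μ * A 0 := by
  have h01 := h.strictAnti hμ hr1 hr2 0
  have h0 := h.pos 0
  have := h.eq_zero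
  nlinarith

/-- Upper pinching of the forced amplitude: `A_0⁴ < 1 + μ r A_0` (from `A_2 < A_1 < 1/A_0` and
`A_0² = A_1(A_2 + μr)`; cf. Lemma 2.3, `A_0 → 1` as `μ → 0`).
[cite: CheskidovFriedlander2009, Lemma 2.3] -/
theorem pow_four_lt (h : IsSteadyState μ r A) (hμ : 0 < μ) (hr1 : 1 < r) (hr2 : r < 2) :
    A 0 ^ 4 < 1 + μ * r * A 0 := by
  have h12 := h.strictAnti hμ hr1 hr2 1
  have h0 := h.pos 0
  have h1 := h.pos 1
  have h2 := h.pos 2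
  have he0 := h.eq_zero
  have he1 := h.eq_succ 0
  simp only [zero_add, pow_one] at he1
  -- `A_0² = A_1 A_2 + μ r A_1 < A_1² + μ r A_1` and `A_0 A_1 = 1 − μA_0 ≤ 1`
  have hA1 : A 0 * A 1 ≤ 1 := by nlinarith
  have hsq : A 0 ^ 2 < A 1 ^ 2 + μ * r * A 1 := by nlinarith
  have hr0 : 0 < μ * r := by
    have : 0 < r := by linarith
    positivity
  have hP0 : 0 < A 0 * A 1 := mul_pos h0 h1
  have hP1 : (A 0 * A 1) ^ 2 ≤ 1 := by nlinarith
  have hP2 : μ * r * (A 0 * A 1) * A 0 ≤ μ * r * A 0 := by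
    have := mul_le_mul_of_nonneg_left hA1 (mul_pos hr0 h0).le
    nlinarith [this]
  calc A 0 ^ 4 = A 0 ^ 2 * A 0 ^ 2 := by ring
    _ < A 0 ^ 2 * (A 1 ^ 2 + μ * r * A 1) := by gcongr
    _ = (A 0 * A 1) ^ 2 + μ * r * (A 0 * A 1) * A 0 := by ring
    _ ≤ 1 + μ * r * A 0 := by linarith

/-- **Injection floor, uniform in the viscosity**: for `μ ≤ 1` (i.e. `ν ≤ 2^{−c/6} f_0^{1/2}`)
every steady state has `A_0 > 1/2`; with `hasSum_dissipation` its total dissipation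
`μ Σ r^j A_j² = A_0` exceeds `1/2` — in the original variables `ν‖α‖²_{H¹} = f_0α_0 >
2^{c/6} f_0^{3/2}/2`, independently of `ν`: the steady-state form of the dissipation anomaly of
op. cit. Thm. 4.2. [cite: CheskidovFriedlander2009, Thm 4.2] -/
theorem half_lt (h : IsSteadyState μ r A) (hμ : 0 < μ) (hμ1 : μ ≤ 1) (hr1 : 1 < r) (hr2 : r < 2) :
    1 / 2 < A 0 := by
  have h1 := h.one_lt hμ hr1 hr2
  have h0 := h.pos 0
  by_contra hle
  push Not at hle
  nlinarith

/-- The dissipation floor as a statement about the series: `1/2 < μ Σ_j r^j A_j²` for every steady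
state with `0 < μ ≤ 1`, `1 < r < 2`. [cite: CheskidovFriedlander2009, Thm 4.2] -/
theorem half_lt_tsum_dissipation (h : IsSteadyState μ r A) (hμ : 0 < μ) (hμ1 : μ ≤ 1)
    (hr1 : 1 < r) (hr2 : r < 2) : 1 / 2 < ∑' j, μ * r ^ j * A j ^ 2 := by
  rw [(h.hasSum_dissipation hμ hr1 hr2).tsum_eq]
  exact h.half_lt hμ hμ1 hr1 hr2

end IsSteadyState

end Literature.Analysis.FluidPDE.CheskidovFriedlander2009

end
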